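import Summits.ResolutionOfSingularities.ResolutionOfSingularities.Theorems.RadicialJungCleanModelsT2MeasureDecrease
import Summits.ResolutionOfSingularities.ResolutionOfSingularities.Theorems.RadicialJungCleanModelsT2PointBlowupSNC
import Literature.AlgebraicGeometry.Resolution.EmbeddedCurvePointBlowups
import Literature.AlgebraicGeometry.Resolution.BlowupsExistence
import Literature.AlgebraicGeometry.Resolution.BlowupsProperProofs
import Summits.ResolutionOfSingularities.ResolutionOfSingularities.Theorems.RadicialJungCleanModelsDimTwoFFiniteGiraudChart
import HarnessLib

/-!
# Route `RadicialJung`, crux `CleanModels` (stmt-15917): assembly of the T2 step from two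
# pointwise inputs (T2 brick B6 — the induction step of Giraud's Thm. 2.4, measure side)

Support file (OURS) for PROGRAMME-clean-dim2 / T2 (`HOME/L/res-L0-w81-pv-2/g5/T2Skeleton.lean`,
architecture `T2-ARCHITECTURE.md` §B2/§B5/§B6), line `via-clean-models` of crux
`DescentPerfectToAll` (stmt-0549). Nothing here is a statement of Hironaka's manuscript.

The skeleton's `stub_step` says: blowing up ONE Giraud-singular point `ξ` of a stage `(X, f)`
with `E(f)` a strict normal crossings divisor yields `π : X₁ → X` with (1) `π` a point blow-up
composition over `E(f)`, (2) `E(π^* f) = π⁻¹ E(f)`, (3) `E(π^* f)` again a strict normal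
crossings divisor, (4) the termination measure STRICTLY SMALLER in the Dershowitz–Manna order.
This file ASSEMBLES (1)–(4) from exactly two pointwise inputs, the rest being bricks already in
the tree:

* (B2) `hB2` — for the blow-up `π` of `X` at `ξ`, `E(π^* f) = π⁻¹ E(f)` (brick B2, res-L0-w81-pv-2);
* (2.3) `h23` — Giraud's Lemme 2.3 at the points OVER `ξ`: every Giraud-singular point `ξ₁` of
  `(X₁, π^* f)` with `π ξ₁ = ξ` has a strictly smaller entry than `ξ` (bricks B4/B5,
  res-L0-w81-pv-1 / pv-2).

Given these: the blow-up exists (`exists_isBlowup`), is a one-step point blow-up composition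
(`IsPointBlowupComposition.single`), is proper hence closed, and is an isomorphism over `X ∖ {ξ}`
(`IsBlowup.isIso_morphismRestrict`); (3) is `T2.isStrictNormalCrossingsDivisor_derivCriticalSet_of_isBlowup_point`
(`…T2PointBlowupSNC.lean`); off `ξ` Giraud-singular points and their entries correspond
(`T2.isGiraudSingularPoint_iff_of_isIso_morphismRestrict`,
`T2.giraudColength_and_ncard_eq_of_isIso_morphismRestrict`, `…T2GiraudInvariantsTransport.lean`),
and the multiset decrease is `T2.isDershowitzMannaLT_measure_of_fibre` (`…T2MeasureDecrease.lean`).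

The entry is kept ABSTRACT: any function `F c n` of Giraud's colength `c = c(X, f, ξ) ∈ ℕ∞` and of
the number `n` of branches of `E(f)` through `ξ`; the skeleton's `entry X f ξ = 2·c.toNat + δ`,
`δ = if n = 1 then 1 else 0`, is the instance `F c n = 2 * c.toNat + if n = 1 then 1 else 0`, and
its `measure X f h = h.toFinset.val.map (entry X f)` is literally the multiset below.

* `exists_step_of_pointwise` — the assembly, for any scheme `X` locally Noetherian with
  `{ξ} ≠ X`;
* `exists_step_of_pointwise'` — the same in the skeleton's binders (integral `X` of dimension
  `2`, where `{ξ} ≠ X` is automatic).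

## References
* J. Giraud, Forme normale d'une fonction sur une surface de caractéristique positive,
  Bull. SMF 111 (1983), Lemme 2.3, Thm. 2.4. [Giraud1983]
-/

noncomputable section

set_option linter.dupNamespace false -- mandated namespace of this single-conjunct summit

open CategoryTheory AlgebraicGeometry TopologicalSpace IsLocalRing
open Literature.AlgebraicGeometry.Resolution

namespace Summit.ResolutionOfSingularities.ResolutionOfSingularities.Theorems.RadicialJung.CleanModels.T2

universe u

open Scheme.IdealSheafData

/-- The abstract entry of a point: a function `F` of Giraud's colength `c(X, f, ξ)` and of the
number of branches of `E(f)` through `ξ`. (The skeleton's `entry` is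
`F c n = 2 * c.toNat + if n = 1 then 1 else 0`.) -/
theorem entryOf_congr (F : ℕ∞ → ℕ → ℕ) {X₁ X : Scheme.{u}} (π : X₁ ⟶ X) (U : X.Opens)
    [IsIso (π ∣_ U)] (f : Γ(X, ⊤)) (x : X₁) (hx : π x ∈ U) :
    F (giraudColength (X₁.presheaf.stalk x) (X₁.presheaf.germ ⊤ x trivial (π.appTop f)))
        (derivCriticalPrimes (X₁.presheaf.stalk x)
          (X₁.presheaf.germ ⊤ x trivial (π.appTop f))).ncard =
      F (giraudColength (X.presheaf.stalk (π x)) (X.presheaf.germ ⊤ (π x) trivial f))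
        (derivCriticalPrimes (X.presheaf.stalk (π x)) (X.presheaf.germ ⊤ (π x) trivial f)).ncard := by
  obtain ⟨h1, h2⟩ := giraudColength_and_ncard_eq_of_isIso_morphismRestrict π U f x hx
  rw [h1, h2]

/-- **The T2 step, assembled from B2 and Lemme 2.3 over the centre.** Let `X` be a locally
Noetherian scheme, `f ∈ Γ(X, 𝒪_X)` with `E(f)` a strict normal crossings divisor, and `ξ` a
Giraud-singular point of `(X, f)` with `{ξ} ≠ X`. Suppose that for every blowing up
`π : X₁ → X` along `𝓘_{ξ}`: (B2) `E(π^* f) = π⁻¹ E(f)`, and (2.3) every Giraud-singular point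
`ξ₁` of `(X₁, π^* f)` over `ξ` has entry `< ` the entry of `ξ` (for a fixed abstract entry
`F`). Then there is a one-step point blow-up composition `π : X₁ → X` over `E(f)` with
`E(π^* f) = π⁻¹ E(f)` a strict normal crossings divisor and the multiset of entries of the
Giraud-singular points of `X₁` strictly below that of `X` in the Dershowitz–Manna order.
[cite: Giraud1983, Lemme 2.3 and Thm. 2.4 (proof)] -/
theorem exists_step_of_pointwise {X : Scheme.{u}} [IsLocallyNoetherian X] (f : Γ(X, ⊤))
    (hsnc : IsStrictNormalCrossingsDivisor X (derivCriticalSet X f))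
    (ξ : X) (hξ : IsGiraudSingularPoint X f ξ) (hne : ({ξ} : Set X) ≠ Set.univ)
    (F : ℕ∞ → ℕ → ℕ)
    (hB2 : ∀ (X₁ : Scheme.{u}) (π : X₁ ⟶ X), IsBlowup π (vanishingIdeal ⟨{ξ}, hξ.1⟩) →
      derivCriticalSet X₁ (π.appTop f) = π ⁻¹' derivCriticalSet X f)
    (h23 : ∀ (X₁ : Scheme.{u}) (π : X₁ ⟶ X), IsBlowup π (vanishingIdeal ⟨{ξ}, hξ.1⟩) →
      ∀ ξ₁ : X₁, IsGiraudSingularPoint X₁ (π.appTop f) ξ₁ → π ξ₁ = ξ →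
        F (giraudColength (X₁.presheaf.stalk ξ₁) (X₁.presheaf.germ ⊤ ξ₁ trivial (π.appTop f)))
            (derivCriticalPrimes (X₁.presheaf.stalk ξ₁)
              (X₁.presheaf.germ ⊤ ξ₁ trivial (π.appTop f))).ncard <
          F (giraudColength (X.presheaf.stalk ξ) (X.presheaf.germ ⊤ ξ trivial f))
            (derivCriticalPrimes (X.presheaf.stalk ξ) (X.presheaf.germ ⊤ ξ trivial f)).ncard) :
    ∃ (X₁ : Scheme.{u}) (π : X₁ ⟶ X), IsPointBlowupComposition (derivCriticalSet X f) π ∧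
      derivCriticalSet X₁ (π.appTop f) = π ⁻¹' derivCriticalSet X f ∧
      IsStrictNormalCrossingsDivisor X₁ (derivCriticalSet X₁ (π.appTop f)) ∧
      ∀ (h : {x : X | IsGiraudSingularPoint X f x}.Finite)
        (h₁ : {x₁ : X₁ | IsGiraudSingularPoint X₁ (π.appTop f) x₁}.Finite),
        Multiset.IsDershowitzMannaLT
          (h₁.toFinset.val.map fun x₁ =>
            F (giraudColength (X₁.presheaf.stalk x₁) (X₁.presheaf.germ ⊤ x₁ trivial (π.appTop f)))
              (derivCriticalPrimes (X₁.presheaf.stalk x₁)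
                (X₁.presheaf.germ ⊤ x₁ trivial (π.appTop f))).ncard)
          (h.toFinset.val.map fun x =>
            F (giraudColength (X.presheaf.stalk x) (X.presheaf.germ ⊤ x trivial f))
              (derivCriticalPrimes (X.presheaf.stalk x) (X.presheaf.germ ⊤ x trivial f)).ncard) := by
  -- the blow-up of `X` at the closed point `ξ`
  obtain ⟨X₁, π, hπ⟩ := exists_isBlowup X (vanishingIdeal ⟨{ξ}, hξ.1⟩)
  have hE := hB2 X₁ π hπ
  have hEcl : IsClosed (derivCriticalSet X f) := hsnc.isClosed
  haveI : IsProper π := hπ.isProper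
  -- `π` is an isomorphism over `U = X ∖ {ξ}`
  let U : X.Opens := ⟨({ξ} : Set X)ᶜ, hξ.1.isOpen_compl⟩
  have hdisj : Disjoint (U : Set X) (vanishingIdeal (⟨{ξ}, hξ.1⟩ : Closeds X)).support := by
    rw [coe_support_vanishingIdeal]
    exact disjoint_compl_left
  haveI : IsIso (π ∣_ U) := hπ.isIso_morphismRestrict hdisj
  have hU : ∀ x₁ : X₁, π x₁ ≠ ξ → π x₁ ∈ U := fun x₁ h => h
  refine ⟨X₁, π, IsPointBlowupComposition.single π ξ hξ.1 hne hξ.2.1 hπ, hE,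
    isStrictNormalCrossingsDivisor_derivCriticalSet_of_isBlowup_point f hsnc hξ.1 hξ.2.1 hπ hE,
    ?_⟩
  -- the measure: fibrewise comparison
  refine isDershowitzMannaLT_measure_of_fibre (P := fun x => IsGiraudSingularPoint X f x)
    (P₁ := fun x₁ => IsGiraudSingularPoint X₁ (π.appTop f) x₁) π _ _ hξ ?_ ?_ ?_
  · intro x₁ hx₁ hne₁
    exact ⟨(isGiraudSingularPoint_iff_of_isIso_morphismRestrict π U π.isClosedMap f x₁ (hU x₁ hne₁)
        hE hEcl).mp hx₁, entryOf_congr F π U f x₁ (hU x₁ hne₁)⟩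
  · intro x₁ y₁ _ _ hne₁ hxy
    have hy₁ : π y₁ ∈ U := by
      change π y₁ ≠ ξ
      rw [← hxy]; exact hne₁
    exact injOn_preimage_of_isIso_morphismRestrict' π U (hU x₁ hne₁) hy₁ hxy
  · intro x₁ hx₁ heq
    exact h23 X₁ π hπ x₁ hx₁ heq

/-- A Giraud-singular point of an integral scheme of non-zero dimension is not the whole scheme.
[folklore] -/
theorem singleton_ne_univ_of_isGiraudSingularPoint {X : Scheme.{u}} [IsIntegral X]
    (hdim : topologicalKrullDim X ≠ 0) {f : Γ(X, ⊤)} {ξ : X} (hξ : IsGiraudSingularPoint X f ξ) :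
    ({ξ} : Set X) ≠ Set.univ := by
  intro h
  have hgen : genericPoint X = ξ := by
    have : genericPoint X ∈ ({ξ} : Set X) := h ▸ Set.mem_univ _
    exact this
  -- `{ξ}` is closed, but the generic point of a positive-dimensional integral scheme is not
  exact not_isClosed_singleton_genericPoint hdim (hgen ▸ hξ.1)

/-- **The T2 step in the skeleton's binders** (`stub_step` of `T2Skeleton.lean` from B2 and
Lemme 2.3 over the centre): `X` integral regular of dimension `2`, locally of finite type over a
field. The conclusion is `stub_step`'s, for the abstract entry `F` (instantiate
`F c n := 2 * c.toNat + if n = 1 then 1 else 0` to get the skeleton's `measure`).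
[cite: Giraud1983, Lemme 2.3 and Thm. 2.4 (proof)] -/
theorem exists_step_of_pointwise' (k : Type u) [Field k] (X : Scheme.{u}) [IsIntegral X]
    (q : X ⟶ Spec (.of k)) [LocallyOfFiniteType q] (hdim : topologicalKrullDim X = 2)
    (f : Γ(X, ⊤)) (hsnc : IsStrictNormalCrossingsDivisor X (derivCriticalSet X f))
    (ξ : X) (hξ : IsGiraudSingularPoint X f ξ) (F : ℕ∞ → ℕ → ℕ)
    (hB2 : ∀ (X₁ : Scheme.{u}) (π : X₁ ⟶ X), IsBlowup π (vanishingIdeal ⟨{ξ}, hξ.1⟩) →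
      derivCriticalSet X₁ (π.appTop f) = π ⁻¹' derivCriticalSet X f)
    (h23 : ∀ (X₁ : Scheme.{u}) (π : X₁ ⟶ X), IsBlowup π (vanishingIdeal ⟨{ξ}, hξ.1⟩) →
      ∀ ξ₁ : X₁, IsGiraudSingularPoint X₁ (π.appTop f) ξ₁ → π ξ₁ = ξ →
        F (giraudColength (X₁.presheaf.stalk ξ₁) (X₁.presheaf.germ ⊤ ξ₁ trivial (π.appTop f)))
            (derivCriticalPrimes (X₁.presheaf.stalk ξ₁)
              (X₁.presheaf.germ ⊤ ξ₁ trivial (π.appTop f))).ncard <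
          F (giraudColength (X.presheaf.stalk ξ) (X.presheaf.germ ⊤ ξ trivial f))
            (derivCriticalPrimes (X.presheaf.stalk ξ) (X.presheaf.germ ⊤ ξ trivial f)).ncard) :
    ∃ (X₁ : Scheme.{u}) (π : X₁ ⟶ X), IsPointBlowupComposition (derivCriticalSet X f) π ∧
      derivCriticalSet X₁ (π.appTop f) = π.base ⁻¹' derivCriticalSet X f ∧
      IsStrictNormalCrossingsDivisor X₁ (derivCriticalSet X₁ (π.appTop f)) ∧
      ∀ (h : {x : X | IsGiraudSingularPoint X f x}.Finite)
        (h₁ : {x₁ : X₁ | IsGiraudSingularPoint X₁ (π.appTop f) x₁}.Finite),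
        Multiset.IsDershowitzMannaLT
          (h₁.toFinset.val.map fun x₁ =>
            F (giraudColength (X₁.presheaf.stalk x₁) (X₁.presheaf.germ ⊤ x₁ trivial (π.appTop f)))
              (derivCriticalPrimes (X₁.presheaf.stalk x₁)
                (X₁.presheaf.germ ⊤ x₁ trivial (π.appTop f))).ncard)
          (h.toFinset.val.map fun x =>
            F (giraudColength (X.presheaf.stalk x) (X.presheaf.germ ⊤ x trivial f))
              (derivCriticalPrimes (X.presheaf.stalk x) (X.presheaf.germ ⊤ x trivial f)).ncard) := by
  haveI : IsLocallyNoetherian X := LocallyOfFiniteType.isLocallyNoetherian q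
  have hne := singleton_ne_univ_of_isGiraudSingularPoint (by rw [hdim]; decide) hξ
  exact exists_step_of_pointwise f hsnc ξ hξ hne F hB2 h23

end Summit.ResolutionOfSingularities.ResolutionOfSingularities.Theorems.RadicialJung.CleanModels.T2

end
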